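/-
Copyright: the b2b-balaban T⁴-continuum CRUX team, row NE7b OWNER lineage `t4-ne7b-p1` (gen 145). Project licence.
-/
import Mathlib

/-!
# THE SUPPORT LETTERS OF THE KERNEL-LETTER CLASS ARE NOT REPRODUCED BY THE FLUCTUATION STEP — A LOCATED NO (SCOPING-d17, the closure
# audit of the class-map iteration (d14)(3), first file).  The class map typed at orders 4 and 5 ((525)–(531), (535); (603)–(634), (641)–(643))
# carries, besides the kernel letters, two SUPPORT letters of the INPUT majorants: `n` with `#{z : Hk_{zy} ≠ 0} ≤ n` (both roles) and `n₃`
# with `Σ_b#{c : K3_{abc} ≠ 0} ≤ n₃` (three roles) — the three-point star terms `𝟙[Hk_{pq} ≠ 0]·C₃∕(ρρ)`, the two-rider terms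
# `𝟙[Hk]𝟙[Hk]·C3h∕(ρρ)` and the supported trees `𝟙[Hk]·C₄·T16`, `𝟙[K3]·C3k∕(ρρ)` are summed over the free index of the pair by COUNTING.
# For the ITERATION the next step's `Hk` is this step's output majorant `Hk⁺_{xz} = Hk_{xz} + E_D(b^z,b^x)` ((484) `output_second_entry_format`;
# `E_D(a,b) = Σ_w(Dᵀa)_w(Dᵀb)_w∕(1−lamA)`, `b^v_w = Σ_u|A_{uw}|Hk_{vu}`).  THIS FILE: an admissible `D` (`δ + D·C ≤ D`, `D ≥ 0`) is POSITIVE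
# along every chain of positive entries of `C` (§1: `D_{xx} ≥ 1`, `D_{xz} > 0 ∧ C_{zy} > 0 ⟹ D_{xy} > 0`, hence `D > 0` on every
# `C`-connected pair — on a connected overlap graph, EVERYWHERE), and then (§2) the two-point increment `E_D(b^z,b^x)` is POSITIVE for all
# `x, z` as soon as no profile `b^v` vanishes identically, so `Hk⁺` has FULL support:
#   `#{z : Hk⁺_{zy} ≠ 0} = |ι|`   for every `y`   (THE END `output_support_count_eq_card`),
# i.e. any letter `n⁺` bounding the output's support count is `≥ |ι|` (`card_le_output_support_letter`) — the VOLUME.  CONSEQUENCE (honest,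
# located): the kernel-letter class {orders 1–5} as typed is a valid ONE-STEP theorem for a FINITE-RANGE input (first step: `U` block-local),
# but it does NOT close under iteration through the support letters: at the second step the order-4 slot letters' `6n·C₃S²` and the order-5
# `10n₃C3kS², 15n²C3hS², 10n·C4·16S′³` are volume factors.  The kernel letters themselves (`hr, hc, k3·, k4·, k5·`, the `κ`'s, the weighted
# profiles) are NOT affected.  REPAIR (SCOPING-d17 (R)): replace counting by WEIGHTED letters — interpolate each supported term between the
# tree-decay bound `Q` and the homogeneous bound `P ∝ Hk_{pq}` (`|entry| ≤ √(PQ)`), and sum the free pair index by weighted Cauchy–Schwarz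
# against a summable-inverse pair weight (next files) (row NE7b, node U5c; Mathlib only; [folklore]).

Cell `pub-balaban`, sub-cell `t4`, spine estimate NE7b (`T4WeightBudget.RelWeightBound`; the cell's OWN estimate — NOT PRINTED in
[Bałaban 1983–89], NOT PROVED).  Crux-route work under `Spine/NE7b/` by the row OWNER (`t4-ne7b-p1` gen 145, file (648)) under FREEZE
(0)'s crux-prover clause; NOTHING of Bałaban's is named as a Lean object, valued or asserted; no `T4Continuum/Support` leaf typed; no
`def`, no notation (`C`, `D`, `b^v`, `E_D` WRITTEN OUT in (484)'s letters); zero `sorry`.  Imports: Mathlib only.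

WHAT IS PROVED ([folklore]): §1 `admissible_diag_pos`, `admissible_step_pos`, **`admissible_pos_of_chain`**; §2 `profile_transport_pos`,
`twoPoint_increment_pos`, THE END **`output_support_count_eq_card`**, **`card_le_output_support_letter`**; §3 toy (two sites).

HONEST (what this is NOT).  A located NO about ONE pair of letters (`n`, `n₃`) of the road's OWN class, with its repair named; it does not
touch the kernel letters, the `C⁵` packaging or the continuity ((639)–(647)); nothing is claimed about Bałaban's (polymer) format, where
locality is kept by construction; scalar skeleton ((A3), NC-NE7b-α UNRULED); nothing of Bałaban's asserted.  BY-NAME EFFECT ON THE WALL: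
NONE.  NE7b NOT PRINTED ∕ NOT PROVED; spine PROVED 0∕9; rung (B)+1 — the programme's measures remain FINITE-torus statements; NOT the mass
gap, NOT Clay.  HONEST DEPENDENCY: continuum YM on T⁴ ⇐ BetaPertH ∧ nine spine estimates (0∕9 proved); BetaPertH ⇐ (D1) ∧ (D4) ∧ CAP+tail;
G-an2-4 gates asym, D1 and NE2∕3∕4.
-/

set_option autoImplicit false

noncomputable section

namespace Summit.QuantumFields.BalabanUV.T4Continuum.NE7b.SupSupportLettersNoGo

open Finset Real
open scoped BigOperators

variable {ι κ : Type} [Fintype ι] [Fintype κ]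

/-! ## §1. An admissible `D` is positive along chains of positive entries of `C` -/

section Admissible

variable [DecidableEq κ] {C D : κ → κ → ℝ}

/-- **Diagonal**: `δ + D·C ≤ D` with `D, C ≥ 0` gives `1 ≤ D_{xx}`. [folklore] -/
theorem admissible_diag_pos (hD : ∀ x y, 0 ≤ D x y) (hC : ∀ x y, 0 ≤ C x y)
    (hDC : ∀ x y, (if x = y then (1 : ℝ) else 0) + ∑ z, D x z * C z y ≤ D x y) (x : κ) : 1 ≤ D x x := by
  have h := hDC x x
  rw [if_pos rfl] at h
  have hs : 0 ≤ ∑ z, D x z * C z x := sum_nonneg fun z _ => mul_nonneg (hD x z) (hC z x)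
  linarith

/-- **One step along the chain**: `D_{xz} > 0` and `C_{zy} > 0` give `D_{xy} > 0`. [folklore] -/
theorem admissible_step_pos (hD : ∀ x y, 0 ≤ D x y) (hC : ∀ x y, 0 ≤ C x y)
    (hDC : ∀ x y, (if x = y then (1 : ℝ) else 0) + ∑ z, D x z * C z y ≤ D x y) {x z y : κ} (hxz : 0 < D x z) (hzy : 0 < C z y) :
    0 < D x y := by
  have h := hDC x y
  have hδ : 0 ≤ (if x = y then (1 : ℝ) else 0) := by split_ifs <;> norm_num
  have hs : D x z * C z y ≤ ∑ z', D x z' * C z' y :=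
    single_le_sum (f := fun z' => D x z' * C z' y) (fun z' _ => mul_nonneg (hD x z') (hC z' y)) (mem_univ z)
  have hp : 0 < D x z * C z y := mul_pos hxz hzy
  linarith

/-- **THE POSITIVITY OF AN ADMISSIBLE `D` ALONG `C`-CHAINS**: if `y` is reached from `x` by a chain of positive entries of `C`, then
`D_{xy} > 0`; with the diagonal, `D > 0` on every `C`-connected pair — on a connected overlap graph an admissible `D` has FULL support.
[folklore] -/
theorem admissible_pos_of_chain (hD : ∀ x y, 0 ≤ D x y) (hC : ∀ x y, 0 ≤ C x y)
    (hDC : ∀ x y, (if x = y then (1 : ℝ) else 0) + ∑ z, D x z * C z y ≤ D x y) {x y : κ}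
    (hxy : Relation.ReflTransGen (fun z y => 0 < C z y) x y) : 0 < D x y := by
  induction hxy with
  | refl => exact lt_of_lt_of_le one_pos (admissible_diag_pos hD hC hDC x)
  | tail _ hzy ih => exact admissible_step_pos hD hC hDC ih hzy

end Admissible

/-! ## §2. THE END: the output Hessian majorant has full support -/

section TheEnd

variable {Hk : ι → ι → ℝ} {A : Matrix ι κ ℝ} {D : κ → κ → ℝ} {lamA : ℝ}

/-- **The transported profile is positive**: `D > 0` and a nonvanishing nonnegative profile `b^v` give `(Dᵀb^v)_w > 0` for every `w`.
[folklore] -/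
theorem profile_transport_pos (hHk0 : ∀ v u, 0 ≤ Hk v u) (hDpos : ∀ z w, 0 < D z w)
    (hb : ∀ v : ι, ∃ z : κ, 0 < ∑ u, |A u z| * Hk v u) (v : ι) (w : κ) : 0 < ∑ z', D z' w * ∑ u, |A u z'| * Hk v u := by
  obtain ⟨z, hz⟩ := hb v
  have hnn : ∀ z' ∈ (univ : Finset κ), 0 ≤ D z' w * ∑ u, |A u z'| * Hk v u := fun z' _ =>
    mul_nonneg (hDpos z' w).le (sum_nonneg fun u _ => mul_nonneg (abs_nonneg _) (hHk0 v u))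
  exact lt_of_lt_of_le (mul_pos (hDpos z w) hz) (single_le_sum (f := fun z' => D z' w * ∑ u, |A u z'| * Hk v u) hnn (mem_univ z))

/-- **The two-point increment `E_D(b^z,b^x)` is positive** for ALL `x, z` (no decay can make it vanish). [folklore] -/
theorem twoPoint_increment_pos [Nonempty κ] (hHk0 : ∀ v u, 0 ≤ Hk v u) (hDpos : ∀ z w, 0 < D z w)
    (hb : ∀ v : ι, ∃ z : κ, 0 < ∑ u, |A u z| * Hk v u) (hlamA1 : lamA < 1) (x z : ι) :
    0 < ∑ w, (∑ z', D z' w * ∑ u, |A u z'| * Hk z u) * (∑ z', D z' w * ∑ u, |A u z'| * Hk x u) / (1 - lamA) := by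
  have hl : 0 < 1 - lamA := sub_pos.2 hlamA1
  obtain ⟨w₀⟩ := ‹Nonempty κ›
  have hnn : ∀ w ∈ (univ : Finset κ), 0 ≤ (∑ z', D z' w * ∑ u, |A u z'| * Hk z u) * (∑ z', D z' w * ∑ u, |A u z'| * Hk x u) / (1 - lamA) :=
    fun w _ => div_nonneg (mul_nonneg (profile_transport_pos hHk0 hDpos hb z w).le (profile_transport_pos hHk0 hDpos hb x w).le) hl.le
  exact lt_of_lt_of_le (div_pos (mul_pos (profile_transport_pos hHk0 hDpos hb z w₀) (profile_transport_pos hHk0 hDpos hb x w₀)) hl)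
    (single_le_sum (f := fun w => (∑ z', D z' w * ∑ u, |A u z'| * Hk z u) * (∑ z', D z' w * ∑ u, |A u z'| * Hk x u) / (1 - lamA)) hnn
      (mem_univ w₀))

/-- **THE END — THE OUTPUT'S SUPPORT COUNT IS THE VOLUME**: for (484)'s output majorant `Hk⁺_{xz} = Hk_{xz} + E_D(b^z,b^x)` (a positive
`D` — every admissible one on a connected overlap graph, §1 — and nonvanishing profiles), `#{z : Hk⁺_{zy} ≠ 0} = |ι|` for every `y`.
[folklore] -/
theorem output_support_count_eq_card [Nonempty κ] (hHk0 : ∀ v u, 0 ≤ Hk v u) (hDpos : ∀ z w, 0 < D z w)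
    (hb : ∀ v : ι, ∃ z : κ, 0 < ∑ u, |A u z| * Hk v u) (hlamA1 : lamA < 1) (y : ι) :
    (univ.filter fun z : ι => Hk z y + ∑ w, (∑ z', D z' w * ∑ u, |A u z'| * Hk y u) * (∑ z', D z' w * ∑ u, |A u z'| * Hk z u) /
      (1 - lamA) ≠ 0).card = Fintype.card ι := by
  rw [← card_univ]
  congr 1
  refine filter_true_of_mem fun z _ => ?_
  exact (lt_of_lt_of_le (twoPoint_increment_pos hHk0 hDpos hb hlamA1 z y) (le_add_of_nonneg_left (hHk0 z y))).ne'

/-- **Any output support letter is at least the volume**: if `#{z : Hk⁺_{zy} ≠ 0} ≤ n⁺` for some `y`, then `|ι| ≤ n⁺`. [folklore] -/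
theorem card_le_output_support_letter [Nonempty κ] (hHk0 : ∀ v u, 0 ≤ Hk v u) (hDpos : ∀ z w, 0 < D z w)
    (hb : ∀ v : ι, ∃ z : κ, 0 < ∑ u, |A u z| * Hk v u) (hlamA1 : lamA < 1) {n' : ℕ} (y : ι)
    (hn' : (univ.filter fun z : ι => Hk z y + ∑ w, (∑ z', D z' w * ∑ u, |A u z'| * Hk y u) * (∑ z', D z' w * ∑ u, |A u z'| * Hk z u) /
      (1 - lamA) ≠ 0).card ≤ n') : Fintype.card ι ≤ n' := by
  rwa [output_support_count_eq_card hHk0 hDpos hb hlamA1 y] at hn'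

end TheEnd

/-! ## §3. Toy -/

/-- Toy (§1 on two sites): with `C₁₂, C₂₁ > 0` an admissible `D` is positive off the diagonal too. -/
example (D C : Fin 2 → Fin 2 → ℝ) (hD : ∀ x y, 0 ≤ D x y) (hC : ∀ x y, 0 ≤ C x y)
    (hDC : ∀ x y, (if x = y then (1 : ℝ) else 0) + ∑ z, D x z * C z y ≤ D x y) (h01 : 0 < C 0 1) : 0 < D 0 1 :=
  admissible_pos_of_chain hD hC hDC (Relation.ReflTransGen.single h01)

end Summit.QuantumFields.BalabanUV.T4Continuum.NE7b.SupSupportLettersNoGo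

end
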